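import Literature.AlgebraicGeometry.Deformation.BaseChangeKernelIdeal
import Literature.AlgebraicGeometry.Motives.Differentials
import Mathlib.AlgebraicGeometry.Morphisms.ClosedImmersion
import HarnessLib

/-!
# The closed-fibre dictionary: `π := i^♯` for the honest closed fibre `X = X₀ ×_{A'⧸J} κ` — QUOTIENT CURRENCY
# ([Hartshorne2010] proof of Thm. 10.2 (a); [GortzWedhorn2020] Prop. 4.20)

Layer `Literature/AlgebraicGeometry/Deformation`, namespace `Literature.AlgebraicGeometry.Deformation.LiftClosedFibreDictionaryQuot`.
PROOF FILE, THEOREMS ONLY (no definition, no instance, no notation, no named fact, no `sorry`).  Sequel head (vii-c) of the (U-glob) organ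
(cell `hodgecm-mathlib`, P6 sub-desk P6b; count-neutral ★ capital): it DISCHARGES the abstract closed-fibre layer `(i, hiV, 𝔪, π, hπ, hπnat)` of ★
`SmoothLiftObstructionClassAtlasQuot` (head (vii-b)) for the ACTUAL closed fibre.

THE PRINT.  [Hartshorne2010, Thm. 10.2 (a), proof, p. 81] works throughout on the closed fibre `X₀` of the given scheme over `C` and its
restrictions `U_{ijk}` («which gives an element in `H⁰(U_{ijk}, T⁰ ⊗ J)`»); [GortzWedhorn2020, Prop. 4.20, p. 104]: «`f⁻¹(V(𝔞)) = V(𝔞𝒪_X)`» — the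
base change of the closed immersion `Spec κ ↪ Spec (A'⧸J)` along `f₀ : X₀ → Spec (A'⧸J)` is the closed subscheme of `X₀` cut out by `𝔪·𝒪_{X₀}`.

SETTING.  `A'` a commutative ring with a residue FIELD `A' ↠ κ` (kernel `𝔪`), `J ≤ 𝔪` an ideal, `φ : A'⧸J → κ` the induced map
(`φ ∘ mk_J = (A' → κ)`); `f₀ : X₀ → Spec (A'⧸J)`; `X : Over (Spec κ)` and a CARTESIAN square `IsPullback i X.hom f₀ (Spec φ)` (`i : X ⟶ X₀`) — e.g.
`X = X₀ ×_{Spec (A'⧸J)} Spec κ`, `i = pr₁`.  The `A'`-algebra structures on sections are the ones the consumers carry: on `X₀` through `f₀`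
(★ `SmoothLiftableCoverQuot.halg_of_structureMorphism`'s `letI`, hypothesis `halg₀`), on `X` through `X.hom` (★ `Motives.constToPresheaf`, the
`halg` of ★ `SmoothLiftObstructionCechCochainQuot`).

* §1 `i` IS A CLOSED IMMERSION (base change of `Spec κ ↪ Spec (A'⧸J)`, Mathlib `IsClosedImmersion.spec_of_surjective` +
  `MorphismProperty.of_isPullback`; named form ★ `Deformation.isClosedImmersion_of_isPullback_fibre`, used inline here), hence AFFINE:
  `i⁻¹ W` is affine for affine `W` (`isAffineOpen_preimage` — the `hiV` of (vii-b)).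
* §2 ON AN AFFINE `W ⊆ X₀`: `i^♯_W : Γ(X₀, W) → Γ(X, i⁻¹W)` is ONTO (Mathlib `Scheme.Hom.app_surjective`) with KERNEL `𝔪 · Γ(X₀, W)`
  (★ `Deformation.ker_app_eq_map_of_isPullback`: the ideal of the base change is `ker φ · 𝒪_{X₀}`, and `ker φ · Γ = 𝔪 · Γ` through `halg₀`) — the `hπ`
  of (vii-b); i.e. affine-locally `Γ(X, i⁻¹W) = Γ(X₀, W) ⧸ 𝔪 Γ(X₀, W) = Γ(X₀, W) ⊗_{A'⧸J} κ`.
* §3 `i^♯` COMMUTES WITH THE `A'`-STRUCTURES (`app_algebraMap`, from `i ≫ f₀ = X.hom ≫ Spec φ`) and IS NATURAL under restriction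
  (`app_naturality` — the `hπnat` of (vii-b)).
* §4 THE PACKAGE `exists_closedFibreMaps`: `∃ π : ∀ W, Γ(X₀, W) →ₐ[A'] Γ(X, i⁻¹W)` with `π W = i^♯_W`, the affine clause and the naturality
  clause; and `exists_closedFibreMaps_atlas` — the same in the letters `(hiV, hπ, hπnat)` of ★ `SmoothLiftObstructionClassAtlasQuot` over a principal
  affine cover `V : ι → X₀.affineOpens`, so that the final consumer binds them by `obtain`.

HC_CM is proved only modulo the printed citations until rung 0 closes; nothing here bears on a summit statement.

## References
* [Hartshorne2010] R. Hartshorne, *Deformation Theory*, GTM 257, Springer (2010): Thm. 10.2 (a) and its proof (p. 81).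
* [GortzWedhorn2020] U. Görtz, T. Wedhorn, *Algebraic Geometry I: Schemes*, 2nd ed. (2020), Prop. 4.20 (p. 104).
* [StacksProject] The Stacks Project, Tag 01JU (base change), Tag 01HQ (closed immersions of affine schemes).
-/

noncomputable section

-- `TopCat.Presheaf`/`TopCat.Sheaf` are not reducible (as in Mathlib's `AlgebraicGeometry/Modules`).
set_option backward.isDefEq.respectTransparency false

open CategoryTheory AlgebraicGeometry Opposite TopologicalSpace

universe u

namespace Literature.AlgebraicGeometry.Deformation.LiftClosedFibreDictionaryQuot

open Literature.AlgebraicGeometry.Motives Literature.AlgebraicGeometry.Deformation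

variable {A' : Type u} [CommRing A'] {κ : Type u} [Field κ] [Algebra A' κ] (hκ : Function.Surjective (algebraMap A' κ))
  (J : Ideal A') (φ : A' ⧸ J →+* κ) (hφ : ∀ a, φ (Ideal.Quotient.mk J a) = algebraMap A' κ a)
  {X₀ : Scheme.{u}} (f₀ : X₀ ⟶ Spec (.of (A' ⧸ J)))
  {X : Over (Spec (CommRingCat.of κ))} (i : X.left ⟶ X₀) (H : IsPullback i X.hom f₀ (Spec.map (CommRingCat.ofHom φ)))

/-! ## §1 `i` is a closed immersion: preimages of affine opens are affine -/

include hκ hφ H in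
/-- **`i⁻¹ W` is affine for affine `W ⊆ X₀`**: `i` is a CLOSED IMMERSION — the base change of the closed immersion `Spec κ ↪ Spec (A'⧸J)`
(`φ` is onto) along `f₀` (Mathlib `IsClosedImmersion.spec_of_surjective` + `MorphismProperty.of_isPullback`; the named form is ★
`Deformation.isClosedImmersion_of_isPullback_fibre`) — hence an affine morphism; this is the hypothesis `hiV` of ★
`SmoothLiftObstructionClassAtlasQuot`. [cite: StacksProject, Tag 01HQ] [cite: Hartshorne2010, Thm. 10.2 (a) (proof), p. 81] -/
theorem isAffineOpen_preimage (W : X₀.Opens) (hW : IsAffineOpen W) : IsAffineOpen (i ⁻¹ᵁ W) := by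
  have hφs : Function.Surjective φ := fun y => (hκ y).elim fun a ha => ⟨Ideal.Quotient.mk J a, (hφ a).trans ha⟩
  haveI : IsClosedImmersion i := MorphismProperty.of_isPullback H.flip (IsClosedImmersion.spec_of_surjective _ hφs)
  exact hW.preimage i

/-! ## §2 On an affine open: `i^♯` is onto with kernel `𝔪 · Γ(X₀, W)` -/

include hκ hφ H in
/-- **`i^♯_W : Γ(X₀, W) ↠ Γ(X, i⁻¹ W)` is onto for affine `W`** (Mathlib `Scheme.Hom.app_surjective` for the closed immersion `i`).
[cite: StacksProject, Tag 01HQ] [cite: Hartshorne2010, Thm. 10.2 (a) (proof), p. 81] -/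
theorem app_surjective (W : X₀.Opens) (hW : IsAffineOpen W) : Function.Surjective (i.app W) := by
  have hφs : Function.Surjective φ := fun y => (hκ y).elim fun a ha => ⟨Ideal.Quotient.mk J a, (hφ a).trans ha⟩
  haveI : IsClosedImmersion i := MorphismProperty.of_isPullback H.flip (IsClosedImmersion.spec_of_surjective _ hφs)
  exact i.app_surjective W hW

include hφ in
/-- `ker φ = 𝔪 ⧸ J`, i.e. `(ker (A' → κ)).map mk_J = ker φ`. [cite: GortzWedhorn2020, Prop. 4.20 (p. 104)] -/
theorem map_mk_ker_eq_ker : (RingHom.ker (algebraMap A' κ)).map (Ideal.Quotient.mk J) = RingHom.ker φ := by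
  have hcomp : φ.comp (Ideal.Quotient.mk J) = algebraMap A' κ := RingHom.ext hφ
  rw [← hcomp, ← RingHom.comap_ker, Ideal.map_comap_of_surjective _ Ideal.Quotient.mk_surjective]

variable [instΓ₀ : ∀ W : X₀.Opens, Algebra A' Γ(X₀, W)]
  (halg₀ : ∀ (W : X₀.Opens) (a : A'),
    algebraMap A' Γ(X₀, W) a = (f₀.appLE ⊤ W le_top) ((Scheme.ΓSpecIso (.of (A' ⧸ J))).inv (Ideal.Quotient.mk J a)))

include hκ hφ H halg₀ in
/-- **`ker i^♯_W = 𝔪 · Γ(X₀, W)` on an affine open `W ⊆ X₀`** («`f⁻¹(V(𝔞)) = V(𝔞𝒪_X)`»: the ideal of the base change `i` is `ker φ · 𝒪_{X₀}` — ★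
`Deformation.ker_app_eq_map_of_isPullback` — and `ker φ · Γ(X₀, W) = 𝔪 · Γ(X₀, W)` because the `A'`-structure of `Γ(X₀, W)` factors through `f₀`
(`halg₀`)).  With §2's surjectivity this is the `hπ` of ★ `SmoothLiftObstructionClassAtlasQuot`: affine-locally `Γ(X, i⁻¹W) = Γ(X₀, W) ⧸ 𝔪 Γ(X₀, W)`.
[cite: GortzWedhorn2020, Prop. 4.20 (p. 104)] [cite: Hartshorne2010, Thm. 10.2 (a) (proof), p. 81] -/
theorem ker_app_eq_map (𝔪 : Ideal A') (h𝔪 : RingHom.ker (algebraMap A' κ) = 𝔪) (W : X₀.Opens) (hW : IsAffineOpen W) :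
    RingHom.ker (i.app W).hom = 𝔪.map (algebraMap A' Γ(X₀, W)) := by
  have key : RingHom.ker (i.app W).hom =
      (RingHom.ker φ).map ((X₀.presheaf.map (homOfLE (le_top : W ≤ ⊤)).op).hom.comp (specStructureMap f₀)) :=
    ker_app_eq_map_of_isPullback φ (fun y => (hκ y).elim fun a ha => ⟨Ideal.Quotient.mk J a, (hφ a).trans ha⟩) H ⟨W, hW⟩
  rw [key, ← map_mk_ker_eq_ker J φ hφ, h𝔪, Ideal.map_map]
  congr 1
  refine RingHom.ext fun a => ?_
  rw [halg₀ W a]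
  rfl

/-! ## §3 `i^♯` commutes with the `A'`-structures and with restriction -/

variable [instΓ : ∀ W : X.left.Opens, Algebra A' Γ(X.left, W)]
  (halg : ∀ (W : X.left.Opens) (a : A'), algebraMap A' Γ(X.left, W) a = (constToPresheaf X).app (op W) (algebraMap A' κ a))

include hφ H halg₀ halg in
/-- **`i^♯` is an `A'`-algebra map:** `i^♯_W (a · 1) = a · 1` — from the square `i ≫ f₀ = X.hom ≫ Spec φ` and the two structure maps
(`halg₀`: through `f₀`, `halg`: through `X.hom`, ★ `Motives.constToPresheaf`). [cite: Hartshorne2010, Thm. 10.2 (a) (proof), p. 81]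
[cite: StacksProject, Tag 01JU] -/
theorem app_algebraMap (W : X₀.Opens) (a : A') : i.app W (algebraMap A' Γ(X₀, W) a) = algebraMap A' Γ(X.left, i ⁻¹ᵁ W) a := by
  rw [halg₀ W a, halg (i ⁻¹ᵁ W) a]
  -- the two composites `Γ(Spec (A'⧸J), ⊤) → Γ(X, i⁻¹ W)` agree by `i ≫ f₀ = X.hom ≫ Spec φ`
  have h1 : f₀.appLE ⊤ W le_top ≫ i.app W = (i ≫ f₀).appLE ⊤ (i ⁻¹ᵁ W) le_top := by
    rw [Scheme.Hom.app_eq_appLE, Scheme.Hom.appLE_comp_appLE]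
  have h2 : (i ≫ f₀).appLE ⊤ (i ⁻¹ᵁ W) le_top =
      (X.hom ≫ Spec.map (CommRingCat.ofHom φ)).appLE ⊤ (i ⁻¹ᵁ W) le_top := by
    simp only [H.w]
  have h3 : (X.hom ≫ Spec.map (CommRingCat.ofHom φ)).appLE ⊤ (i ⁻¹ᵁ W) le_top =
      (Spec.map (CommRingCat.ofHom φ)).appTop ≫ X.hom.appLE ⊤ (i ⁻¹ᵁ W) le_top := by
    rw [Scheme.Hom.comp_appLE]
    rfl
  have h4 : (Scheme.ΓSpecIso (.of (A' ⧸ J))).inv ≫ (Spec.map (CommRingCat.ofHom φ)).appTop =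
      CommRingCat.ofHom φ ≫ (Scheme.ΓSpecIso (.of κ)).inv :=
    (Scheme.ΓSpecIso_inv_naturality (CommRingCat.ofHom φ)).symm
  have key : (Scheme.ΓSpecIso (.of (A' ⧸ J))).inv ≫ f₀.appLE ⊤ W le_top ≫ i.app W =
      CommRingCat.ofHom φ ≫ (Scheme.ΓSpecIso (.of κ)).inv ≫ X.hom.appLE ⊤ (i ⁻¹ᵁ W) le_top := by
    rw [h1, h2, h3, ← Category.assoc, h4, Category.assoc]
  change ((Scheme.ΓSpecIso (.of (A' ⧸ J))).inv ≫ f₀.appLE ⊤ W le_top ≫ i.app W) (Ideal.Quotient.mk J a) = _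
  rw [key]
  change X.hom.appLE ⊤ (i ⁻¹ᵁ W) le_top ((Scheme.ΓSpecIso (.of κ)).inv (φ (Ideal.Quotient.mk J a))) = _
  rw [hφ a]
  rfl

omit instΓ₀ instΓ in
/-- **`i^♯` is natural under restriction:** `(i^♯_W x)|_{i⁻¹W′} = i^♯_{W′} (x|_{W′})` — the `hπnat` of ★ `SmoothLiftObstructionClassAtlasQuot`
(Mathlib `Scheme.Hom.naturality`). [cite: Hartshorne2010, Thm. 10.2 (a) (proof), p. 81] -/
theorem app_naturality ⦃W W' : X₀.Opens⦄ (h : W' ≤ W) (x : Γ(X₀, W)) :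
    X.left.presheaf.map (homOfLE (i.preimage_mono h)).op (i.app W x) = i.app W' (X₀.presheaf.map (homOfLE h).op x) := by
  have key := congrArg (fun ψ => (ψ : Γ(X₀, W) ⟶ Γ(X.left, i ⁻¹ᵁ W')) x) (i.naturality (homOfLE h).op)
  simp only [CommRingCat.comp_apply] at key
  exact key.symm

/-! ## §4 The package in the letters of ★ `SmoothLiftObstructionClassAtlasQuot` -/

include hκ hφ H halg₀ halg in
/-- **THE CLOSED-FIBRE MAPS `π := i^♯`, PACKAGED:** there is `π : ∀ W, Γ(X₀, W) →ₐ[A'] Γ(X, i⁻¹ W)` with `π W = i^♯_W`, onto with kernel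
`𝔪 · Γ(X₀, W)` on every AFFINE `W`, and natural under restriction. [cite: Hartshorne2010, Thm. 10.2 (a) (proof), p. 81]
[cite: GortzWedhorn2020, Prop. 4.20 (p. 104)] -/
theorem exists_closedFibreMaps (𝔪 : Ideal A') (h𝔪 : RingHom.ker (algebraMap A' κ) = 𝔪) :
    ∃ π : (W : X₀.Opens) → Γ(X₀, W) →ₐ[A'] Γ(X.left, i ⁻¹ᵁ W),
      (∀ (W : X₀.Opens) (x : Γ(X₀, W)), π W x = i.app W x) ∧
      (∀ W : X₀.Opens, IsAffineOpen W → Function.Surjective (π W) ∧ RingHom.ker (π W) = 𝔪.map (algebraMap A' Γ(X₀, W))) ∧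
      ∀ ⦃W W' : X₀.Opens⦄ (h : W' ≤ W) (x : Γ(X₀, W)),
        X.left.presheaf.map (homOfLE (i.preimage_mono h)).op (π W x) = π W' (X₀.presheaf.map (homOfLE h).op x) := by
  refine ⟨fun W => ⟨(i.app W).hom, fun a => app_algebraMap J φ hφ f₀ i H halg₀ halg W a⟩, fun W x => rfl,
    fun W hW => ⟨app_surjective hκ J φ hφ f₀ i H W hW, ker_app_eq_map hκ J φ hφ f₀ i H halg₀ 𝔪 h𝔪 W hW⟩,
    fun W W' h x => app_naturality i h x⟩

include hκ hφ H halg₀ halg in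
/-- **The same over a principal affine cover `V : ι → X₀.affineOpens`, in the EXACT binder shapes `(hiV, π, hπ, hπnat)` of ★
`SmoothLiftObstructionClassAtlasQuot`** (principal opens `W = D(q) ⊆ V_a` are affine, Mathlib `IsAffineOpen.basicOpen`): the final consumer
`obtain`s them here for `X := X₀ ×_{A'⧸J} κ`. [cite: Hartshorne2010, Thm. 10.2 (a) (proof), p. 81] [cite: GortzWedhorn2020, Prop. 4.20 (p. 104)] -/
theorem exists_closedFibreMaps_atlas (𝔪 : Ideal A') (h𝔪 : RingHom.ker (algebraMap A' κ) = 𝔪) {ι : Type*} (V : ι → X₀.affineOpens) :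
    ∃ (_ : ∀ a, IsAffineOpen (i ⁻¹ᵁ (V a).1)) (π : (W : X₀.Opens) → Γ(X₀, W) →ₐ[A'] Γ(X.left, i ⁻¹ᵁ W)),
      (∀ (W : X₀.Opens) (x : Γ(X₀, W)), π W x = i.app W x) ∧
      (∀ (a : ι) (W : X₀.Opens), W ≤ (V a).1 → (∃ q : Γ(X₀, (V a).1), W = X₀.basicOpen q) →
        Function.Surjective (π W) ∧ RingHom.ker (π W) = 𝔪.map (algebraMap A' Γ(X₀, W))) ∧
      ∀ ⦃W W' : X₀.Opens⦄ (h : W' ≤ W) (x : Γ(X₀, W)),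
        X.left.presheaf.map (homOfLE (i.preimage_mono h)).op (π W x) = π W' (X₀.presheaf.map (homOfLE h).op x) := by
  obtain ⟨π, hπi, hπ, hπnat⟩ := exists_closedFibreMaps hκ J φ hφ f₀ i H halg₀ halg 𝔪 h𝔪
  refine ⟨fun a => isAffineOpen_preimage hκ J φ hφ f₀ i H _ (V a).2, π, hπi, fun a W _ hq => ?_, hπnat⟩
  obtain ⟨q, rfl⟩ := hq
  exact hπ _ ((V a).2.basicOpen q)

end Literature.AlgebraicGeometry.Deformation.LiftClosedFibreDictionaryQuot

end
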